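import Summits.Ventures.PercRepro.S4UpsCellP10D10
import Summits.Ventures.PercRepro.S4SevenPhi
import Summits.Ventures.PercRepro.GenQNineSevenAssembly
import Summits.Ventures.PercRepro.RankLevelSetColoopDevice
import Summits.Ventures.PercRepro.RankLevelSetCoreSixColoopFree
import Summits.Ventures.PercRepro.RankLevelSetDeleteColoops
import Summits.Ventures.PercRepro.S1LadderQ
import Summits.Ventures.PercRepro.S2LPColoops
import Summits.Ventures.PercRepro.S1RowNineAll
import Summits.Ventures.PercRepro.S1RowSevenAll
import Summits.Ventures.PercRepro.RankLevelSetPlaneTenPrime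

/-!
# PercRepro — THE CORE CELL `(10, 10)` OF THE 10 ROW AT LEVEL `7` BY THE COLOOP DEVICE WITH THE LOSSY LADDER (p7 g23, S4 feeder;
p8's device shape, tools/gen_row10.py)

`k = #coloops`: `k = 0` the LP cell `(10, 10)` (`S3LP.s7lp_10_20`, natural constant `5/2`); `k = 1` night-4's row `9` at level `7`
on the coloop-free core (`Night4.rls_nine_seven`, `Φ(9,7) = 9/8 ≥ 1/4 = (Φ(10,7) − 2)/2`) through the lossy ladder
`S2LP.phi_mul_topCount_le_of_delete_coloops` (`Φ ≤ 2^k·κ + 2(2^k − 1)`); `k ≥ 2` retired by `S1.rls_of_coloops_lossy_q`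
(`Φ(10,7) = 5/2 ≤ 2(2^2 − 1) = 6`). Hence **`c025_core_seven_ten_10 : RLS M 10 7`** on every `e`-free core of rank `10`, corank `10`.
Axioms: standard.
-/

open scoped Matroid

namespace PercRepro

namespace ThmN

open Set Matroid

variable {α : Type}

/-- **THE CORE CELL `(10, 10)`, every `e`-free core** — unconditional, by the coloop device with the lossy ladder. -/
theorem c025_core_seven_ten_10 (M : Matroid α) [M.Finite]
    (hR : M.eRank = (10 : ℕ∞)) (hn : M.E.ncard = 10 + 10)
    (hfree : ∀ e ∈ M.E, ∃ A ⊆ M.E \ {e}, e ∉ M.closure A ∧ e ∉ M.closure ((M.E \ {e}) \ A)) : RLS M 10 7 := by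
  classical
  have hfin : M.coloops.Finite := M.ground_finite.subset (Matroid.coloops_subset_ground M)
  set K : Finset α := hfin.toFinset with hKdef
  have hKset : (K : Set α) = M.coloops := by rw [hKdef, Set.Finite.coe_toFinset]
  have hK : ∀ e ∈ K, M.IsColoop e := fun e he => by
    rw [hKdef, Set.Finite.mem_toFinset] at he
    exact he
  have hR' : M.eRank = ((10 : ℕ) : ℕ∞) := hR
  have hKcard : K.card = M.coloops.ncard := by rw [← hKset, Set.ncard_coe_finset]
  by_cases hge : 2 ≤ K.card
  · -- two coloops or more: the lossy ladder retires the cell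
    exact S1.rls_of_coloops_lossy_q M (p := 8) (q := 7) (c := 2) hR' (by norm_num) (by norm_num) (by omega)
      (by norm_num [S4Ups.phiK_ten_seven])
  obtain ⟨hn0, hR0, hfree0, -⟩ := delete_coloops_core_data M K hK hR' hn hfree
  by_cases hk0 : K.card = 0
  · -- coloop-free: the natural cell `(10, 10)`
    have hcf : ∀ e ∈ M.E, ¬ M.IsColoop e := by
      intro e _ he
      have : e ∈ (K : Set α) := by rw [hKset]; exact he
      rw [Finset.card_eq_zero.1 hk0] at this
      simp at this
    have hcol : M.coloops = ∅ := coloops_eq_empty_of_forall M hcf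
    have hcell := S3LP.s7lp_10_20 M hR' hn hcol (S1.pairs_of_free M hfree) (S1.lines_of_free M hfree)
      (S1.planes_of_free M hfree) (S1.tens_of_free M hfree)
      (fun X hX h => ncard_le_nineteen_of_eRk_le_five_of_free M hfree hX h)
    rw [RLS_iff, S4Ups.phiK_ten_seven]
    exact hcell
  · -- exactly one coloop: night-4's row `9` at level `7` on the core, at `1/4` through the lossy ladder
    have hk1 : K.card = 1 := by omega
    have h9 := Night4.rls_nine_seven (M ＼ (K : Set α))
    rw [RLS_iff, S4Ups.phiK_nine_seven, hKset] at h9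
    have hU : (0 : ℚ) ≤ (Matroid.topCount (M ＼ M.coloops) 9 7 : ℚ) := by positivity
    have h : (1 / 4 : ℚ) * (Matroid.topCount (M ＼ M.coloops) 9 7 : ℚ) ≤ (Matroid.midCount (M ＼ M.coloops) 9 7 : ℚ) := by
      linarith
    have hc : M.coloops.ncard = 1 := by omega
    have hmain := S2LP.phi_mul_topCount_le_of_delete_coloops M (p := 9) (q := 7) (c := 1) hR' (by norm_num) (by norm_num) hc
      (Φ := phiK 10 7) (κ := 1 / 4) (by norm_num [S4Ups.phiK_ten_seven]) h
    rw [RLS_iff]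
    exact hmain

end ThmN

end PercRepro
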